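/-
Copyright (c) 2026 the pub-hodgecm-mathlib formalisation cell (harness21).  Prover seat hodgecm-mathlib-K2E5-p17 (g9), Track B «K2-LIT»,
#184♮ = hLiu418 = `stmt-HodgeConjecture-24832`; socket #41, K1-a♮ — brick (K1a-supp½): the TOP's K1-a♮ support letter `hsuppa` from a PER-TERM, PER-PLACE lattice letter
on the explicit rank-one expression of ★ p863404 §2 (K2E4-p10 (g10) suggestion 00:08Z; K1a line lead K2E5-p16 (g8)).  THEOREMS ONLY; NO `Lines` import.
-/
import Summits.HodgeConjecture.HodgeConjecture.Theorems.K2LiuKindOneSingularTermPackage     -- ★ p863404 (K2E4-p10): §2's currency (the explicit `X S s h`)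
import Summits.HodgeConjecture.HodgeConjecture.Theorems.K2LiuSiegelEisensteinKindWInstance    -- ★ p862446 (K2E4-p10): `exists_den_of_local_letters`, `two_le_absNorm`
import Summits.HodgeConjecture.HodgeConjecture.Theorems.K2LiuStandardFamilyUniformLevel        -- ★ p863294 (ρ7) (K2E3-p03): `exists_levelSubgroup_of_isStandardSectionFamily`, `conj_mem_of_archPart_eq_one` (ED. 2, §3)
import HarnessLib

/-!
# Crux `HLiu418`, socket #41, K1-a♮ — (K1a-supp½): `hsuppa` OF ★ p863404 §2 FROM A PER-TERM, PER-PLACE LATTICE LETTER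

Cell `hodgecm-mathlib`, crux item hLiu418 = `stmt-HodgeConjecture-24832` (helper lane `--supports … --as helper`, count-neutral); squad K2 ∕ K2Liu; K1a line lead K2E5-p16 (g8);
prover K2E5-p17 (g9).

THE SLOT.  ★ p863404 `K2LiuKindOneSingularTermPackage.exists_kindOne_singularTermPackage_of_placeLetters` (§2) takes BY VALUE, on `{n∕2 < re s}` and for rank-one `S`
(`↑S ≠ 0`, `det ↑S = 0`), the support letter `hsupp` about the EXPLICIT expression
`X S s h = c S h · (Σ_{i ∈ I S h} Ac S i s h · ∏_{v ∈ T S h} Gn S i v s h) · ((∏_{v ∈ Pm S h} c¹_v(s)⁻¹) · G s) · ∏_{v ∈ D S h} P S h v s`: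
`X S s h ≠ 0 ⟹ ∃ D ≥ 1, D ≤ Ca·‖h‖^{κa}, D·S integral`.  Its content is LOCAL: if `X ≠ 0` then some pure-tensor term `Ac S i s h · ∏_v Gn S i v s h` is non-zero, so `Ac S i s h ≠ 0` and
EVERY local factor `Gn S i v s h ≠ 0` (`v ∈ T S h`) — and a non-vanishing twisted local value pins the index into a lattice controlled by the level of `h_v` (★ p863373
`v_le_exp_of_ballPresented_ne_zero`: `N ≠ 0 ⟹ |σ|_w ≤ q_w^{m − d}`), while off `T S h` the index is integral by the construction of `T S h`.  THIS FILE is the algebra in between,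
hypothesis-first on the per-term, per-place lattice letter `hterm` (for every rank-one `S`, `s` in the half-plane, `h`, every `i ∈ I S h` with `Ac S i s h ≠ 0` and all `Gn S i v s h ≠ 0`
on `T S h`: at every finite place `w` of `L` an exponent `m` with `N(𝔭_w)^m ≤ N(𝔭_w)^{δ_w}·H_w(h)^k` and `|S_{ab}|_w ≤ q_w^m`), and the global denominator is ★ p862446
`exists_den_of_local_letters` (`Ca = (∏_{w∈T_δ} N(𝔭_w)^{δ_w})·(n+n)^k`, `κa = k`).
* §1 `exists_term_ne_zero_of_X_ne_zero` — `X S s h ≠ 0 ⟹ ∃ i ∈ I S h, Ac S i s h ≠ 0 ∧ ∀ v ∈ T S h, Gn S i v s h ≠ 0` (pure algebra: `Finset.exists_ne_zero_of_sum_ne_zero`,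
  `Finset.prod_ne_zero_iff`).
* §2 **`hsupp_of_termPlaceSupport`** — `hterm ⟹ ∃ Ca κa, 0 < Ca ∧ 0 ≤ κa ∧ ‹§2's hsupp BYTES›`.
References: [MoeglinWaldspurger1995] II.1.7, IV.1.9; [Shimura1997] §18.4 Prop. 18.14; [BorelJacquet1979] §1.2; [NeukirchANT1999] Ch. II §3.
HONEST LABEL.  Count-neutral helper: `HC_CM` is proved only modulo the 7 printed citations (2 remaining named inputs: hLiu418 = `stmt-HodgeConjecture-24832`,
h413 = `stmt-HodgeConjecture-24833`) until rung 0 closes; this file closes no socket.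
-/

set_option autoImplicit false
set_option linter.dupNamespace false -- the mandated namespace repeats `HodgeConjecture.HodgeConjecture`

noncomputable section

open scoped Matrix NNReal BigOperators
open NumberField IsDedekindDomain
open Literature.NumberTheory.Automorphic Literature.NumberTheory.Automorphic.UnitaryGroup Literature.NumberTheory.GaloisRepresentations
open Literature.NumberTheory.LFunctions
open Literature.NumberTheory.GelbartRogawski1991 Literature.NumberTheory.GelbartRogawski1991.GRConstruction
open Literature.NumberTheory.K2Lit.SiegelDoubled

namespace Summit.HodgeConjecture.HodgeConjecture.Cruxes.HLiu418.K2LiuKindOneSingularSupportOfLetters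

open K2LiuSiegelUnipotentFourierDefs K2LiuSiegelUnipotentCharacters
open K2LiuSiegelEisensteinKindWInstance (exists_den_of_local_letters two_le_absNorm)

/-! ## §1 A non-zero sum of pure tensors has a non-zero term with all its local factors non-zero -/

/-- **`c · (Σ_{i∈I} A_i · ∏_{v∈T} G_{i v}) · B · P ≠ 0 ⟹ ∃ i ∈ I, A_i ≠ 0 ∧ ∀ v ∈ T, G_{i v} ≠ 0`** (pure algebra). [folklore] -/
theorem exists_term_ne_zero_of_mul_sum_mul_ne_zero {ι ι' : Type*} (I : Finset ι') (T : Finset ι) (c B P : ℂ) (A : ι' → ℂ) (G : ι' → ι → ℂ)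
    (hX : c * (∑ i ∈ I, A i * ∏ v ∈ T, G i v) * B * P ≠ 0) : ∃ i ∈ I, A i ≠ 0 ∧ ∀ v ∈ T, G i v ≠ 0 := by
  have hsum : ∑ i ∈ I, A i * ∏ v ∈ T, G i v ≠ 0 := (mul_ne_zero_iff.1 (mul_ne_zero_iff.1 (mul_ne_zero_iff.1 hX).1).1).2
  obtain ⟨i, hi, hne⟩ := Finset.exists_ne_zero_of_sum_ne_zero hsum
  exact ⟨i, hi, (mul_ne_zero_iff.1 hne).1, fun v hv => Finset.prod_ne_zero_iff.1 (mul_ne_zero_iff.1 hne).2 v hv⟩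

/-! ## §2 `hsuppa` of ★ p863404 §2 from the per-term, per-place lattice letter -/

open Classical in
/-- **(K1a-supp½) THE SUPPORT LETTER OF THE EXPLICIT RANK-ONE EXPRESSION FROM A PER-TERM, PER-PLACE LATTICE LETTER.**  In ★ p863404 §2's currency (abstract index types
`ι ι' κ`; constant `c`, pure-tensor index `I`, local index `T`, continued letters `Ac`, `Gn`, moving exceptional set `Pm`, scalar `G`, shells `D`, `P`): IF for every rank-one `S`, every
`s` with `n∕2 < re s`, every `h`, and every term `i ∈ I S h` with `Ac S i s h ≠ 0` and `Gn S i v s h ≠ 0` for all `v ∈ T S h`, there is at every finite place `w` of `L` an `m ∈ ℕ` with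
`N(𝔭_w)^m ≤ N(𝔭_w)^{δ_w}·H_w(h)^k` and `|S_{ab}|_w ≤ q_w^m` (`hterm`; defects `δ` supported on `T_δ`), THEN §2's `hsupp` holds with `Ca = (∏_{w∈T_δ} N(𝔭_w)^{δ_w})·(n+n)^k`,
`κa = k`: `X S s h ≠ 0 ⟹ ∃ D ≥ 1, D ≤ Ca·‖h‖^{κa}, D·S integral` (§1 + ★ `exists_den_of_local_letters`).
[cite: MoeglinWaldspurger1995, II.1.7, IV.1.9] [cite: Shimura1997, §18.4 Prop. 18.14] [cite: BorelJacquet1979, §1.2] [cite: NeukirchANT1999, Ch. II §3] -/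
theorem hsupp_of_termPlaceSupport
    (L : Type) [Field L] [NumberField L] [IsCMField L] {n : ℕ} (e : Fin 2 × Fin 1 ≃ Fin n)
    (dV : Fin 2 → L) (hdV : ∀ i, IsCMField.complexConj L (dV i) = dV i)
    (dW : Fin 1 → L) (hdW : ∀ i, IsCMField.complexConj L (dW i) = dW i)
    {ι ι' κ : Type*}
    (c : skewMatrices ((IsCMField.complexConj L : L ≃ₐ[Fp L] L) : L →+* L) ((gramR L e dV hdV dW hdW).map (algebraMap (Fp L) L)) → HA L e dV hdV dW hdW → ℂ)
    (I : skewMatrices ((IsCMField.complexConj L : L ≃ₐ[Fp L] L) : L →+* L) ((gramR L e dV hdV dW hdW).map (algebraMap (Fp L) L)) → HA L e dV hdV dW hdW → Finset ι')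
    (T : skewMatrices ((IsCMField.complexConj L : L ≃ₐ[Fp L] L) : L →+* L) ((gramR L e dV hdV dW hdW).map (algebraMap (Fp L) L)) → HA L e dV hdV dW hdW → Finset ι)
    (Ac : skewMatrices ((IsCMField.complexConj L : L ≃ₐ[Fp L] L) : L →+* L) ((gramR L e dV hdV dW hdW).map (algebraMap (Fp L) L)) → ι' → ℂ → HA L e dV hdV dW hdW → ℂ)
    (Gn : skewMatrices ((IsCMField.complexConj L : L ≃ₐ[Fp L] L) : L →+* L) ((gramR L e dV hdV dW hdW).map (algebraMap (Fp L) L)) → ι' → ι → ℂ → HA L e dV hdV dW hdW → ℂ)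
    (Pm : skewMatrices ((IsCMField.complexConj L : L ≃ₐ[Fp L] L) : L →+* L) ((gramR L e dV hdV dW hdW).map (algebraMap (Fp L) L)) → HA L e dV hdV dW hdW →
      Finset (HeightOneSpectrum (𝓞 ↥(maximalRealSubfield L))))
    (G : ℂ → ℂ)
    (D : skewMatrices ((IsCMField.complexConj L : L ≃ₐ[Fp L] L) : L →+* L) ((gramR L e dV hdV dW hdW).map (algebraMap (Fp L) L)) → HA L e dV hdV dW hdW → Finset κ)
    (P : skewMatrices ((IsCMField.complexConj L : L ≃ₐ[Fp L] L) : L →+* L) ((gramR L e dV hdV dW hdW).map (algebraMap (Fp L) L)) → HA L e dV hdV dW hdW → κ → ℂ → ℂ)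
    -- the defect datum and the per-term, per-place lattice letter
    (Tδ : Finset (HeightOneSpectrum (𝓞 L))) (δ : HeightOneSpectrum (𝓞 L) → ℕ) (hδ : ∀ w ∉ Tδ, δ w = 0) (k : ℕ)
    (hterm : ∀ (S : skewMatrices ((IsCMField.complexConj L : L ≃ₐ[Fp L] L) : L →+* L) ((gramR L e dV hdV dW hdW).map (algebraMap (Fp L) L))),
      (S : Matrix (Fin n) (Fin n) L) ≠ 0 → (S : Matrix (Fin n) (Fin n) L).det = 0 → ∀ (s : ℂ) (h : HA L e dV hdV dW hdW), (n : ℝ) / 2 < s.re →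
      ∀ i ∈ I S h, Ac S i s h ≠ 0 → (∀ v ∈ T S h, Gn S i v s h ≠ 0) →
      ∀ w : HeightOneSpectrum (𝓞 L), ∃ m : ℕ,
        ((Ideal.absNorm w.asIdeal : ℕ) : ℝ) ^ m ≤ ((Ideal.absNorm w.asIdeal : ℕ) : ℝ) ^ δ w * (GLn.localHeight (n + n) L w (h : GL (Fin (n + n)) (AdeleRing (𝓞 L) L)) : ℝ) ^ k ∧
          ∀ a b, Valued.v ((((S : Matrix (Fin n) (Fin n) L) a b : L)) : w.adicCompletion L) ≤ WithZero.exp (m : ℤ)) :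
    ∃ Ca κa : ℝ, 0 < Ca ∧ 0 ≤ κa ∧
      ∀ (S : skewMatrices ((IsCMField.complexConj L : L ≃ₐ[Fp L] L) : L →+* L) ((gramR L e dV hdV dW hdW).map (algebraMap (Fp L) L))) (s : ℂ) (h : HA L e dV hdV dW hdW),
      (n : ℝ) / 2 < s.re → (S : Matrix (Fin n) (Fin n) L) ≠ 0 → (S : Matrix (Fin n) (Fin n) L).det = 0 →
      c S h * (∑ i ∈ I S h, Ac S i s h * ∏ v ∈ T S h, Gn S i v s h) * ((∏ v ∈ Pm S h, ((1 - (v.residueCard : ℂ) ^ (-(2 * s))) / ((1 - (v.residueCard : ℂ) ^ (-(2 * s + 1))) * (1 - (quadraticHeckeCharCM L).valueAtUniformizer v * (v.residueCard : ℂ) ^ (-(2 * s + 2)))))) * G s) * ∏ v ∈ D S h, P S h v s ≠ 0 →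
      ∃ D : ℕ, 1 ≤ D ∧ (D : ℝ) ≤ Ca * adelicHeightGL (n + n) L (h : GL (Fin (n + n)) (AdeleRing (𝓞 L) L)) ^ κa ∧
        ∀ i j, IsIntegral ℤ ((D : L) * (S : Matrix (Fin n) (Fin n) L) i j) := by
  -- the frame has `n = 2`, so `n + n ≠ 0`
  have hn : n = 2 := by simpa using (Fintype.card_congr e).symm
  haveI : NeZero (n + n) := ⟨by omega⟩
  have hq0 : ∀ w : HeightOneSpectrum (𝓞 L), (0 : ℝ) < ((Ideal.absNorm w.asIdeal : ℕ) : ℝ) := fun w => by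
    have h2 := two_le_absNorm L w
    exact_mod_cast (show 0 < Ideal.absNorm w.asIdeal by omega)
  have hN : (0 : ℝ) < (((n + n : ℕ)) : ℝ) := by exact_mod_cast (show 0 < n + n by omega)
  refine ⟨(∏ w ∈ Tδ, ((Ideal.absNorm w.asIdeal : ℕ) : ℝ) ^ δ w) * (((n + n : ℕ)) : ℝ) ^ k, k,
    mul_pos (Finset.prod_pos fun w _ => pow_pos (hq0 w) _) (pow_pos hN k), Nat.cast_nonneg k, fun S s h hs hS0 hdet hX => ?_⟩
  -- one non-zero pure-tensor term
  obtain ⟨i, hi, hAc, hGn⟩ := exists_term_ne_zero_of_mul_sum_mul_ne_zero (I S h) (T S h) (c S h) _ _ (fun i => Ac S i s h) (fun i v => Gn S i v s h) hX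
  -- the per-place lattice letter for that term, then the global denominator
  exact exists_den_of_local_letters L (S : Matrix (Fin n) (Fin n) L) (h : GL (Fin (n + n)) (AdeleRing (𝓞 L) L)) Tδ δ hδ k
    (hterm S hS0 hdet s h hs i hi hAc hGn)

/-! ## §3 (ED. 2 — K2Liu-p14 (g5), K1b∕ρ desk; brick (K1a-supp), K1a desk K2E5-p16 (g8) WORD 2026-09-05T00:49:53Z (2)) `hsuppa` of ★ p863404 §2 INTRINSICALLY:
the twisted big-cell integral is `N_Δ(𝔸)`-equivariant, so a non-zero coefficient kills `ψ_S` on the translated level — the K1-b♮ road of ★ `K2LiuKindOneLineSupportIntrinsic`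

THE POINT ([MoeglinWaldspurger1995, I.2.6, II.1.7], [Shimura1997, §18.4 Prop. 18.14], [KudlaRallis1994, §2]).  On `{n∕2 < re s}` the explicit rank-one expression `X S s h` of
§2 IS `(s − ½)·(∫β)⁻¹·W_S(f_s)(h)` (★ p863404 §2's tail identity `htail` with `hsplit`, `hA`, `hW` and ★ `sub_half_mul_scalarK1_union_eq`; `hXW_of_tailLetters`), and the
twisted big-cell integral `W_S(f)(h) = ∫_{N_Δ(𝔸)} conj ψ_S(u) f(w_Δ u h) du` satisfies `W_S(f)(u₀ h) = ψ_S(u₀)·W_S(f)(h)` for EVERY `u₀ ∈ N_Δ(𝔸)` (left-invariance of `νN`,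
commutativity of `N_Δ(𝔸)` ★ `mul_comm_of_mem_unipDelta`; NO integrability needed: `whittakerDelta_unipDelta_mul`).  If `f` is right-invariant under `k = h⁻¹ u₀ h` then also
`W_S(f)(u₀ h) = W_S(f)(h·k) = W_S(f)(h)`, so **`W_S(f)(h) ≠ 0 ⟹ ψ_S(u₀) = 1`** (`unipDeltaChar_eq_one_of_whittakerDelta_ne_zero`) — an INTRINSIC lattice condition on `S` at
the translated level of the family (★ (ρ7) `exists_levelSubgroup_of_isStandardSectionFamily`, read through ★ `conj_mem_of_archPart_eq_one`), UNIFORM IN `S` (no rank-one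
presentation, no corner scalar, no translate height: the per-place road's letter (d) is not `S`-uniform — K2Liu-p03 (g8) 2026-09-05T01:00:10Z).  The lattice letters `hlatU`
of K1-b♮ (★ p863430's binder, for every open level `U ≤ H(𝔸_f)`; payer ★ (lat-c)∕(lat-d) `K2LiuKindOneLineLatticeLocal.hlatU_holds`) convert it into the per-place currency of
★ `exists_den_of_local_letters`, whence **`hsupp_of_latticeLetters`**: §2's `hsupp` with `Ca = (∏_{w∈T_δ} N(𝔭_w)^{δ_w})·(n+n)^k`, `κa = k` — from the SAME two by-value
letters as K1-b♮'s (supp½) (`hlatU`, and the level inside ★ (ρ7)), plus the half-plane link `hXW` which `hXW_of_tailLetters` pays from §2's own identity letters. -/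

section Intrinsic

open scoped ENNReal ComplexConjugate
open MeasureTheory MeasureTheory.Measure
open K2LiuStandardFamilyUniformLevel (exists_levelSubgroup_of_isStandardSectionFamily conj_mem_of_archPart_eq_one)
open K2LiuKindOneSingularScalarChangeOfSet (sub_half_mul_scalarK1_union_eq)

/-! ### §3.1 `N_Δ(𝔸)`-equivariance of the twisted big-cell integral and the intrinsic lattice condition -/

/-- **`W_S(f)(u₀ · h) = ψ_S(u₀) · W_S(f)(h)`** for `u₀ ∈ N_Δ(𝔸)`: substitute `u ↦ u₀ u` (left-invariance of `νN`), commute `u u₀ = u₀ u` (★ `mul_comm_of_mem_unipDelta`), and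
split `conj ψ_S(u u₀) = conj ψ_S(u) · conj ψ_S(u₀)` (★ `unipDeltaChar_mul`); `ψ_S(u₀) · conj ψ_S(u₀) = 1`.  No integrability hypothesis (both sides are the same Bochner
integral up to the unit `ψ_S(u₀)`). [cite: MoeglinWaldspurger1995, I.2.6] [cite: KudlaRallis1994, §2] [cite: Shimura1997, §18.1] -/
theorem whittakerDelta_unipDelta_mul
    (L : Type) [Field L] [NumberField L] [IsCMField L] {n : ℕ} (e : Fin 2 × Fin 1 ≃ Fin n)
    (dV : Fin 2 → L) (hdV : ∀ i, IsCMField.complexConj L (dV i) = dV i)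
    (dW : Fin 1 → L) (hdW : ∀ i, IsCMField.complexConj L (dW i) = dW i)
    [MeasurableSpace (unipDelta L e dV hdV dW hdW)] [BorelSpace (unipDelta L e dV hdV dW hdW)]
    (νN : Measure (unipDelta L e dV hdV dW hdW)) [νN.IsMulLeftInvariant]
    (S : Matrix (Fin n) (Fin n) L) (f : HA L e dV hdV dW hdW → ℂ) (h : HA L e dV hdV dW hdW) (u₀ : unipDelta L e dV hdV dW hdW) :
    whittakerDelta L e dV hdV dW hdW νN S f ((u₀ : HA L e dV hdV dW hdW) * h) =
      (unipDeltaChar L e dV hdV dW hdW S (u₀ : HA L e dV hdV dW hdW) : ℂ) * whittakerDelta L e dV hdV dW hdW νN S f h := by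
  rw [whittakerDelta_def, whittakerDelta_def, ← integral_const_mul,
    ← integral_mul_left_eq_self (fun u : unipDelta L e dV hdV dW hdW =>
      (unipDeltaChar L e dV hdV dW hdW S (u₀ : HA L e dV hdV dW hdW) : ℂ) *
        (conj (unipDeltaChar L e dV hdV dW hdW S (u : HA L e dV hdV dW hdW) : ℂ) *
          f (weylDelta L e dV hdV dW hdW * (u : HA L e dV hdV dW hdW) * h))) u₀]
  refine integral_congr_ae (Filter.Eventually.of_forall fun u => ?_)
  have hc : ((u₀ * u : unipDelta L e dV hdV dW hdW) : HA L e dV hdV dW hdW) = (u : HA L e dV hdV dW hdW) * (u₀ : HA L e dV hdV dW hdW) := by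
    rw [Subgroup.coe_mul]
    exact mul_comm_of_mem_unipDelta L e dV hdV dW hdW u₀.2 u.2
  have hψ : (unipDeltaChar L e dV hdV dW hdW S (u₀ : HA L e dV hdV dW hdW) : ℂ) * conj (unipDeltaChar L e dV hdV dW hdW S (u₀ : HA L e dV hdV dW hdW) : ℂ) = 1 := by
    rw [← Circle.coe_inv_eq_conj, ← Circle.coe_mul, mul_inv_cancel, Circle.coe_one]
  show conj (unipDeltaChar L e dV hdV dW hdW S (u : HA L e dV hdV dW hdW) : ℂ) * f (weylDelta L e dV hdV dW hdW * (u : HA L e dV hdV dW hdW) * ((u₀ : HA L e dV hdV dW hdW) * h)) =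
    (unipDeltaChar L e dV hdV dW hdW S (u₀ : HA L e dV hdV dW hdW) : ℂ) *
      (conj (unipDeltaChar L e dV hdV dW hdW S ((u₀ * u : unipDelta L e dV hdV dW hdW) : HA L e dV hdV dW hdW) : ℂ) *
        f (weylDelta L e dV hdV dW hdW * ((u₀ * u : unipDelta L e dV hdV dW hdW) : HA L e dV hdV dW hdW) * h))
  rw [hc, unipDeltaChar_mul L e dV hdV dW hdW S u.2 u₀.2, Circle.coe_mul, map_mul]
  simp only [mul_assoc]
  rw [show (unipDeltaChar L e dV hdV dW hdW S (u₀ : HA L e dV hdV dW hdW) : ℂ) *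
      (conj (unipDeltaChar L e dV hdV dW hdW S (u : HA L e dV hdV dW hdW) : ℂ) * (conj (unipDeltaChar L e dV hdV dW hdW S (u₀ : HA L e dV hdV dW hdW) : ℂ) *
        f (weylDelta L e dV hdV dW hdW * ((u : HA L e dV hdV dW hdW) * ((u₀ : HA L e dV hdV dW hdW) * h))))) =
      ((unipDeltaChar L e dV hdV dW hdW S (u₀ : HA L e dV hdV dW hdW) : ℂ) * conj (unipDeltaChar L e dV hdV dW hdW S (u₀ : HA L e dV hdV dW hdW) : ℂ)) *
        (conj (unipDeltaChar L e dV hdV dW hdW S (u : HA L e dV hdV dW hdW) : ℂ) *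
          f (weylDelta L e dV hdV dW hdW * ((u : HA L e dV hdV dW hdW) * ((u₀ : HA L e dV hdV dW hdW) * h)))) by ring,
    hψ, one_mul]

/-- **A NON-ZERO TWISTED BIG-CELL INTEGRAL KILLS `ψ_S` ON THE TRANSLATED LEVEL.**  If `f` is right-invariant under `k = h⁻¹ u₀ h` (`u₀ ∈ N_Δ(𝔸)`), then
`W_S(f)(u₀ h) = W_S(f)(h k) = W_S(f)(h)` by inspection of the integrand, while `W_S(f)(u₀ h) = ψ_S(u₀) W_S(f)(h)` (`whittakerDelta_unipDelta_mul`); hence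
`W_S(f)(h) ≠ 0 ⟹ ψ_S(u₀) = 1` — the intrinsic lattice condition, uniform in `S`. [cite: MoeglinWaldspurger1995, I.2.6, II.1.7] [cite: Shimura1997, §18.4 Prop. 18.14] -/
theorem unipDeltaChar_eq_one_of_whittakerDelta_ne_zero
    (L : Type) [Field L] [NumberField L] [IsCMField L] {n : ℕ} (e : Fin 2 × Fin 1 ≃ Fin n)
    (dV : Fin 2 → L) (hdV : ∀ i, IsCMField.complexConj L (dV i) = dV i)
    (dW : Fin 1 → L) (hdW : ∀ i, IsCMField.complexConj L (dW i) = dW i)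
    [MeasurableSpace (unipDelta L e dV hdV dW hdW)] [BorelSpace (unipDelta L e dV hdV dW hdW)]
    (νN : Measure (unipDelta L e dV hdV dW hdW)) [νN.IsMulLeftInvariant]
    (S : Matrix (Fin n) (Fin n) L) (f : HA L e dV hdV dW hdW → ℂ) (h : HA L e dV hdV dW hdW) (u₀ : unipDelta L e dV hdV dW hdW)
    (hf : ∀ x : HA L e dV hdV dW hdW, f (x * (h⁻¹ * (u₀ : HA L e dV hdV dW hdW) * h)) = f x)
    (hW : whittakerDelta L e dV hdV dW hdW νN S f h ≠ 0) :
    unipDeltaChar L e dV hdV dW hdW S (u₀ : HA L e dV hdV dW hdW) = 1 := by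
  have h1 : whittakerDelta L e dV hdV dW hdW νN S f ((u₀ : HA L e dV hdV dW hdW) * h) = whittakerDelta L e dV hdV dW hdW νN S f h := by
    rw [whittakerDelta_def, whittakerDelta_def]
    refine integral_congr_ae (Filter.Eventually.of_forall fun u => ?_)
    have hx : weylDelta L e dV hdV dW hdW * (u : HA L e dV hdV dW hdW) * ((u₀ : HA L e dV hdV dW hdW) * h) =
        weylDelta L e dV hdV dW hdW * (u : HA L e dV hdV dW hdW) * h * (h⁻¹ * (u₀ : HA L e dV hdV dW hdW) * h) := by group
    show conj (unipDeltaChar L e dV hdV dW hdW S (u : HA L e dV hdV dW hdW) : ℂ) * f (weylDelta L e dV hdV dW hdW * (u : HA L e dV hdV dW hdW) * ((u₀ : HA L e dV hdV dW hdW) * h)) =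
      conj (unipDeltaChar L e dV hdV dW hdW S (u : HA L e dV hdV dW hdW) : ℂ) * f (weylDelta L e dV hdV dW hdW * (u : HA L e dV hdV dW hdW) * h)
    rw [hx, hf]
  rw [whittakerDelta_unipDelta_mul] at h1
  exact Circle.coe_eq_one.1 ((mul_eq_right₀ hW).1 h1)

/-! ### §3.2 The head: `hsuppa` of ★ p863404 §2 from the lattice letters of K1-b♮ and the half-plane link -/

open Classical in
/-- **(K1a-supp) THE SUPPORT LETTER OF THE EXPLICIT RANK-ONE EXPRESSION, INTRINSICALLY.**  Socket prefix (frame, a standard section family `f` over a standard Iwasawa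
datum — its uniform level is ★ (ρ7) —, the measure `νN` on `N_Δ(𝔸)`) and §2's abstract objects `c I T Ac Gn Pm G D P`; BY VALUE: the half-plane link
`hXW : X S s h ≠ 0 ⟹ W_S(f_s)(h) ≠ 0` (rank-one `S`, `n∕2 < re s`; payer `hXW_of_tailLetters` from §2's identity letters) and the lattice letters `hlatU` for every open level
`U ≤ H(𝔸_f)` (★ p863430's binder VERBATIM; payer ★ `K2LiuKindOneLineLatticeLocal.hlatU_holds`).  THEN §2's `hsupp`:
`X S s h ≠ 0 ⟹ ∃ D : ℕ, 1 ≤ D ∧ D ≤ Ca·‖h‖^{κa} ∧ ∀ i j, IsIntegral ℤ (D·S_{ij})`, `Ca = (∏_{w∈T_δ} N(𝔭_w)^{δ_w})·(n+n)^k`, `κa = k` — by §3.1 at the level `Kf` of the family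
(★ `exists_levelSubgroup_of_isStandardSectionFamily`, ★ `conj_mem_of_archPart_eq_one`), `hlatU`, and ★ `exists_den_of_local_letters`.
[cite: MoeglinWaldspurger1995, II.1.7, IV.1.9] [cite: Shimura1997, §18.4 Prop. 18.14] [cite: BorelJacquet1979, §1.2] [cite: NeukirchANT1999, Ch. II §3] -/
theorem hsupp_of_latticeLetters
    (L : Type) [Field L] [NumberField L] [IsCMField L] {n : ℕ} (e : Fin 2 × Fin 1 ≃ Fin n)
    (dV : Fin 2 → L) (hdV : ∀ i, IsCMField.complexConj L (dV i) = dV i)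
    (dW : Fin 1 → L) (hdW : ∀ i, IsCMField.complexConj L (dW i) = dW i)
    {χ : HeckeCharacter L} (𝒦 : IwasawaDatum L e dV hdV dW hdW) (h𝒦 : 𝒦.IsStd) (f : ℂ → HA L e dV hdV dW hdW → ℂ)
    (hstd : IsStandardSectionFamily 𝒦 χ f) (hcont : ∀ s, Continuous (f s))
    [MeasurableSpace (unipDelta L e dV hdV dW hdW)] [BorelSpace (unipDelta L e dV hdV dW hdW)]
    (νN : Measure (unipDelta L e dV hdV dW hdW)) [νN.IsMulLeftInvariant]
    {ι ι' κ : Type*}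
    (c : skewMatrices ((IsCMField.complexConj L : L ≃ₐ[Fp L] L) : L →+* L) ((gramR L e dV hdV dW hdW).map (algebraMap (Fp L) L)) → HA L e dV hdV dW hdW → ℂ)
    (I : skewMatrices ((IsCMField.complexConj L : L ≃ₐ[Fp L] L) : L →+* L) ((gramR L e dV hdV dW hdW).map (algebraMap (Fp L) L)) → HA L e dV hdV dW hdW → Finset ι')
    (T : skewMatrices ((IsCMField.complexConj L : L ≃ₐ[Fp L] L) : L →+* L) ((gramR L e dV hdV dW hdW).map (algebraMap (Fp L) L)) → HA L e dV hdV dW hdW → Finset ι)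
    (Ac : skewMatrices ((IsCMField.complexConj L : L ≃ₐ[Fp L] L) : L →+* L) ((gramR L e dV hdV dW hdW).map (algebraMap (Fp L) L)) → ι' → ℂ → HA L e dV hdV dW hdW → ℂ)
    (Gn : skewMatrices ((IsCMField.complexConj L : L ≃ₐ[Fp L] L) : L →+* L) ((gramR L e dV hdV dW hdW).map (algebraMap (Fp L) L)) → ι' → ι → ℂ → HA L e dV hdV dW hdW → ℂ)
    (Pm : skewMatrices ((IsCMField.complexConj L : L ≃ₐ[Fp L] L) : L →+* L) ((gramR L e dV hdV dW hdW).map (algebraMap (Fp L) L)) → HA L e dV hdV dW hdW →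
      Finset (HeightOneSpectrum (𝓞 ↥(maximalRealSubfield L))))
    (G : ℂ → ℂ)
    (D : skewMatrices ((IsCMField.complexConj L : L ≃ₐ[Fp L] L) : L →+* L) ((gramR L e dV hdV dW hdW).map (algebraMap (Fp L) L)) → HA L e dV hdV dW hdW → Finset κ)
    (P : skewMatrices ((IsCMField.complexConj L : L ≃ₐ[Fp L] L) : L →+* L) ((gramR L e dV hdV dW hdW).map (algebraMap (Fp L) L)) → HA L e dV hdV dW hdW → κ → ℂ → ℂ)
    -- the half-plane link BY VALUE: `X ≠ 0 ⟹ W_S(f_s)(h) ≠ 0` (payer: `hXW_of_tailLetters`)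
    (hXW : ∀ (S : skewMatrices ((IsCMField.complexConj L : L ≃ₐ[Fp L] L) : L →+* L) ((gramR L e dV hdV dW hdW).map (algebraMap (Fp L) L))),
      (S : Matrix (Fin n) (Fin n) L) ≠ 0 → (S : Matrix (Fin n) (Fin n) L).det = 0 → ∀ (s : ℂ) (h : HA L e dV hdV dW hdW), (n : ℝ) / 2 < s.re →
      c S h * (∑ i ∈ I S h, Ac S i s h * ∏ v ∈ T S h, Gn S i v s h) * ((∏ v ∈ Pm S h, ((1 - (v.residueCard : ℂ) ^ (-(2 * s))) / ((1 - (v.residueCard : ℂ) ^ (-(2 * s + 1))) * (1 - (quadraticHeckeCharCM L).valueAtUniformizer v * (v.residueCard : ℂ) ^ (-(2 * s + 2)))))) * G s) * ∏ v ∈ D S h, P S h v s ≠ 0 →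
      whittakerDelta L e dV hdV dW hdW νN (S : Matrix (Fin n) (Fin n) L) (f s) h ≠ 0)
    -- (P-supp-lat) the lattice letters, for EVERY open level `U ≤ H(𝔸_f)` (by value; ★ p863430's binder VERBATIM)
    (hlatU : ∀ U : Subgroup (UnitaryGroup.finAdelic (Fp L) L (IsCMField.complexConj L) (n + n) (hermD L e dV hdV dW hdW)),
      IsOpen (U : Set (UnitaryGroup.finAdelic (Fp L) L (IsCMField.complexConj L) (n + n) (hermD L e dV hdV dW hdW))) →
      ∃ (Tδ : Finset (HeightOneSpectrum (𝓞 L))) (δ : HeightOneSpectrum (𝓞 L) → ℕ) (k : ℕ), (∀ w ∉ Tδ, δ w = 0) ∧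
        ∀ (S : skewMatrices ((IsCMField.complexConj L : L ≃ₐ[Fp L] L) : L →+* L) ((gramR L e dV hdV dW hdW).map (algebraMap (Fp L) L)))
          (h : HA L e dV hdV dW hdW),
          (∀ b : unipDelta L e dV hdV dW hdW,
            UnitaryGroup.archPart (Fp L) L (IsCMField.complexConj L) (n + n) (hermD L e dV hdV dW hdW) (b : HA L e dV hdV dW hdW) = 1 →
            UnitaryGroup.finPart (Fp L) L (IsCMField.complexConj L) (n + n) (hermD L e dV hdV dW hdW) (h⁻¹ * (b : HA L e dV hdV dW hdW) * h) ∈ U →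
            unipDeltaChar L e dV hdV dW hdW (S : Matrix (Fin n) (Fin n) L) (b : HA L e dV hdV dW hdW) = 1) →
          ∀ w : HeightOneSpectrum (𝓞 L), ∃ m : ℕ,
            ((Ideal.absNorm w.asIdeal : ℕ) : ℝ) ^ m ≤
                ((Ideal.absNorm w.asIdeal : ℕ) : ℝ) ^ δ w * (GLn.localHeight (n + n) L w (h : GL (Fin (n + n)) (AdeleRing (𝓞 L) L)) : ℝ) ^ k ∧
              ∀ a b, Valued.v ((((S : Matrix (Fin n) (Fin n) L) a b : L)) : w.adicCompletion L) ≤ WithZero.exp (m : ℤ)) :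
    ∃ Ca κa : ℝ, 0 < Ca ∧ 0 ≤ κa ∧
      ∀ (S : skewMatrices ((IsCMField.complexConj L : L ≃ₐ[Fp L] L) : L →+* L) ((gramR L e dV hdV dW hdW).map (algebraMap (Fp L) L))) (s : ℂ) (h : HA L e dV hdV dW hdW),
      (n : ℝ) / 2 < s.re → (S : Matrix (Fin n) (Fin n) L) ≠ 0 → (S : Matrix (Fin n) (Fin n) L).det = 0 →
      c S h * (∑ i ∈ I S h, Ac S i s h * ∏ v ∈ T S h, Gn S i v s h) * ((∏ v ∈ Pm S h, ((1 - (v.residueCard : ℂ) ^ (-(2 * s))) / ((1 - (v.residueCard : ℂ) ^ (-(2 * s + 1))) * (1 - (quadraticHeckeCharCM L).valueAtUniformizer v * (v.residueCard : ℂ) ^ (-(2 * s + 2)))))) * G s) * ∏ v ∈ D S h, P S h v s ≠ 0 →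
      ∃ D : ℕ, 1 ≤ D ∧ (D : ℝ) ≤ Ca * adelicHeightGL (n + n) L (h : GL (Fin (n + n)) (AdeleRing (𝓞 L) L)) ^ κa ∧
        ∀ i j, IsIntegral ℤ ((D : L) * (S : Matrix (Fin n) (Fin n) L) i j) := by
  -- the frame has `n = 2`, so `n + n ≠ 0`
  have hn : n = 2 := by simpa using (Fintype.card_congr e).symm
  haveI : NeZero (n + n) := ⟨by omega⟩
  have hq0 : ∀ w : HeightOneSpectrum (𝓞 L), (0 : ℝ) < ((Ideal.absNorm w.asIdeal : ℕ) : ℝ) := fun w => by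
    have h2 := two_le_absNorm L w
    exact_mod_cast (show 0 < Ideal.absNorm w.asIdeal by omega)
  have hN : (0 : ℝ) < (((n + n : ℕ)) : ℝ) := by exact_mod_cast (show 0 < n + n by omega)
  -- the level of the family (★ (ρ7)) and the lattice letters at that level
  obtain ⟨U, Kf, hUo, hKfiff, -, hKf⟩ := exists_levelSubgroup_of_isStandardSectionFamily h𝒦 hstd hcont
  obtain ⟨Tδ, δ, k, hδ, hlat'⟩ := hlatU U hUo
  refine ⟨(∏ w ∈ Tδ, ((Ideal.absNorm w.asIdeal : ℕ) : ℝ) ^ δ w) * (((n + n : ℕ)) : ℝ) ^ k, k,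
    mul_pos (Finset.prod_pos fun w _ => pow_pos (hq0 w) _) (pow_pos hN k), Nat.cast_nonneg k, fun S s h hs hS0 hdet hX => ?_⟩
  -- `W_S(f_s)(h) ≠ 0`, so `ψ_S ≡ 1` on the translated level (§3.1); then the lattice letters and the global denominator
  have hWne := hXW S hS0 hdet s h hs hX
  exact exists_den_of_local_letters L (S : Matrix (Fin n) (Fin n) L) (h : GL (Fin (n + n)) (AdeleRing (𝓞 L) L)) Tδ δ hδ k
    (hlat' S h fun b hb hfin => unipDeltaChar_eq_one_of_whittakerDelta_ne_zero L e dV hdV dW hdW νN (S : Matrix (Fin n) (Fin n) L) (f s) h b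
      (fun x => hKf s x _ (conj_mem_of_archPart_eq_one hKfiff hb h hfin)) hWne)

/-! ### §3.3 The half-plane link from §2's identity letters: `X S s h = (s − ½)·(∫β)⁻¹·W_S(f_s)(h)` on `{n∕2 < re s}` -/

/-- **THE PAYER OF `hXW` FROM ★ p863404 §2's OWN LETTERS.**  With §2's exceptional set `T″` and scalar `G` (`hsc`), the moving set `Pm` (`hPT`), the head `HT` and the tail
identity `htail`, the presentation `hsplit` and the continued letters `hA`, `hW` (all VERBATIM from ★ `exists_kindOne_singularTermPackage_of_placeLetters`): for rank-one `S` and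
`n∕2 < re s`, `(s − ½)·((∫β)⁻¹ • W_S(f_s)(h)) = X S s h` (★ `sub_half_mul_scalarK1_union_eq`, exactly ★ p863404's `hEac` computation), hence `X S s h ≠ 0 ⟹ W_S(f_s)(h) ≠ 0`.
[cite: Tan1999, §4 Prop. 4.8] [cite: KudlaRallis1994, §2 (2.10)–(2.12)] [cite: KudlaSweet1997, §1] -/
theorem hXW_of_tailLetters
    (L : Type) [Field L] [NumberField L] [IsCMField L] {n : ℕ} (e : Fin 2 × Fin 1 ≃ Fin n)
    (dV : Fin 2 → L) (hdV : ∀ i, IsCMField.complexConj L (dV i) = dV i)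
    (dW : Fin 1 → L) (hdW : ∀ i, IsCMField.complexConj L (dW i) = dW i)
    (f : ℂ → HA L e dV hdV dW hdW → ℂ)
    [MeasurableSpace (unipDelta L e dV hdV dW hdW)] (νN : Measure (unipDelta L e dV hdV dW hdW)) (β : unipDelta L e dV hdV dW hdW → ℝ≥0∞)
    (T'' : Set (HeightOneSpectrum (𝓞 ↥(maximalRealSubfield L))))
    (G : ℂ → ℂ)
    (hsc : ∀ s : ℂ, 1 / 2 < s.re →
      (s - 1 / 2) *
        (partialStandardL T'' (fun _ => {1}) (2 * s) /
          (partialStandardL T'' (fun _ => {1}) (2 * s + 1) *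
            partialStandardL T'' (fun v => {(quadraticHeckeCharCM L).valueAtUniformizer v}) (2 * s + 2))) = G s)
    {ι ι' κ : Type*}
    (c : skewMatrices ((IsCMField.complexConj L : L ≃ₐ[Fp L] L) : L →+* L) ((gramR L e dV hdV dW hdW).map (algebraMap (Fp L) L)) → HA L e dV hdV dW hdW → ℂ)
    (D : skewMatrices ((IsCMField.complexConj L : L ≃ₐ[Fp L] L) : L →+* L) ((gramR L e dV hdV dW hdW).map (algebraMap (Fp L) L)) → HA L e dV hdV dW hdW → Finset κ)
    (P : skewMatrices ((IsCMField.complexConj L : L ≃ₐ[Fp L] L) : L →+* L) ((gramR L e dV hdV dW hdW).map (algebraMap (Fp L) L)) → HA L e dV hdV dW hdW → κ → ℂ → ℂ)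
    (Pm : skewMatrices ((IsCMField.complexConj L : L ≃ₐ[Fp L] L) : L →+* L) ((gramR L e dV hdV dW hdW).map (algebraMap (Fp L) L)) → HA L e dV hdV dW hdW → Finset (HeightOneSpectrum (𝓞 ↥(maximalRealSubfield L))))
    (hPT : ∀ (S : skewMatrices ((IsCMField.complexConj L : L ≃ₐ[Fp L] L) : L →+* L) ((gramR L e dV hdV dW hdW).map (algebraMap (Fp L) L))) (h : HA L e dV hdV dW hdW), ∀ v ∈ Pm S h, v ∉ T'')
    (HT : skewMatrices ((IsCMField.complexConj L : L ≃ₐ[Fp L] L) : L →+* L) ((gramR L e dV hdV dW hdW).map (algebraMap (Fp L) L)) → ℂ → HA L e dV hdV dW hdW → ℂ)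
    (htail : ∀ S : skewMatrices ((IsCMField.complexConj L : L ≃ₐ[Fp L] L) : L →+* L) ((gramR L e dV hdV dW hdW).map (algebraMap (Fp L) L)),
      (S : Matrix (Fin n) (Fin n) L) ≠ 0 → (S : Matrix (Fin n) (Fin n) L).det = 0 → ∀ (s : ℂ) (h : HA L e dV hdV dW hdW), 1 < s.re →
        ((∫⁻ u, β u ∂νN).toReal⁻¹ : ℝ) • whittakerDelta L e dV hdV dW hdW νN (S : Matrix (Fin n) (Fin n) L) (f s) h =
          c S h * HT S s h *
            (partialStandardL (T'' ∪ (↑(Pm S h) : Set (HeightOneSpectrum (𝓞 ↥(maximalRealSubfield L))))) (fun _ => {1}) (2 * s) /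
              (partialStandardL (T'' ∪ (↑(Pm S h) : Set (HeightOneSpectrum (𝓞 ↥(maximalRealSubfield L))))) (fun _ => {1}) (2 * s + 1) *
                partialStandardL (T'' ∪ (↑(Pm S h) : Set (HeightOneSpectrum (𝓞 ↥(maximalRealSubfield L))))) (fun v => {(quadraticHeckeCharCM L).valueAtUniformizer v}) (2 * s + 2))) *
            ∏ v ∈ D S h, P S h v s)
    (I : skewMatrices ((IsCMField.complexConj L : L ≃ₐ[Fp L] L) : L →+* L) ((gramR L e dV hdV dW hdW).map (algebraMap (Fp L) L)) → HA L e dV hdV dW hdW → Finset ι')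
    (T : skewMatrices ((IsCMField.complexConj L : L ≃ₐ[Fp L] L) : L →+* L) ((gramR L e dV hdV dW hdW).map (algebraMap (Fp L) L)) → HA L e dV hdV dW hdW → Finset ι)
    (A : skewMatrices ((IsCMField.complexConj L : L ≃ₐ[Fp L] L) : L →+* L) ((gramR L e dV hdV dW hdW).map (algebraMap (Fp L) L)) → ι' → ℂ → HA L e dV hdV dW hdW → ℂ)
    (W : skewMatrices ((IsCMField.complexConj L : L ≃ₐ[Fp L] L) : L →+* L) ((gramR L e dV hdV dW hdW).map (algebraMap (Fp L) L)) → ι' → ι → ℂ → HA L e dV hdV dW hdW → ℂ)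
    (hsplit : ∀ S : skewMatrices ((IsCMField.complexConj L : L ≃ₐ[Fp L] L) : L →+* L) ((gramR L e dV hdV dW hdW).map (algebraMap (Fp L) L)),
      (S : Matrix (Fin n) (Fin n) L) ≠ 0 → (S : Matrix (Fin n) (Fin n) L).det = 0 → ∀ (s : ℂ), 1 < s.re → ∀ (h : HA L e dV hdV dW hdW),
        HT S s h = ∑ i ∈ I S h, A S i s h * ∏ v ∈ T S h, W S i v s h)
    (Ac : skewMatrices ((IsCMField.complexConj L : L ≃ₐ[Fp L] L) : L →+* L) ((gramR L e dV hdV dW hdW).map (algebraMap (Fp L) L)) → ι' → ℂ → HA L e dV hdV dW hdW → ℂ)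
    (hA : ∀ S : skewMatrices ((IsCMField.complexConj L : L ≃ₐ[Fp L] L) : L →+* L) ((gramR L e dV hdV dW hdW).map (algebraMap (Fp L) L)),
      (S : Matrix (Fin n) (Fin n) L) ≠ 0 → (S : Matrix (Fin n) (Fin n) L).det = 0 → ∀ (h : HA L e dV hdV dW hdW), ∀ i ∈ I S h, ∀ s : ℂ, 1 < s.re → A S i s h = Ac S i s h)
    (Gn : skewMatrices ((IsCMField.complexConj L : L ≃ₐ[Fp L] L) : L →+* L) ((gramR L e dV hdV dW hdW).map (algebraMap (Fp L) L)) → ι' → ι → ℂ → HA L e dV hdV dW hdW → ℂ)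
    (hW : ∀ S : skewMatrices ((IsCMField.complexConj L : L ≃ₐ[Fp L] L) : L →+* L) ((gramR L e dV hdV dW hdW).map (algebraMap (Fp L) L)),
      (S : Matrix (Fin n) (Fin n) L) ≠ 0 → (S : Matrix (Fin n) (Fin n) L).det = 0 → ∀ (h : HA L e dV hdV dW hdW), ∀ i ∈ I S h, ∀ v ∈ T S h,
        ∀ s : ℂ, 1 < s.re → W S i v s h = Gn S i v s h) :
    ∀ (S : skewMatrices ((IsCMField.complexConj L : L ≃ₐ[Fp L] L) : L →+* L) ((gramR L e dV hdV dW hdW).map (algebraMap (Fp L) L))),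
      (S : Matrix (Fin n) (Fin n) L) ≠ 0 → (S : Matrix (Fin n) (Fin n) L).det = 0 → ∀ (s : ℂ) (h : HA L e dV hdV dW hdW), (n : ℝ) / 2 < s.re →
      c S h * (∑ i ∈ I S h, Ac S i s h * ∏ v ∈ T S h, Gn S i v s h) * ((∏ v ∈ Pm S h, ((1 - (v.residueCard : ℂ) ^ (-(2 * s))) / ((1 - (v.residueCard : ℂ) ^ (-(2 * s + 1))) * (1 - (quadraticHeckeCharCM L).valueAtUniformizer v * (v.residueCard : ℂ) ^ (-(2 * s + 2)))))) * G s) * ∏ v ∈ D S h, P S h v s ≠ 0 →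
      whittakerDelta L e dV hdV dW hdW νN (S : Matrix (Fin n) (Fin n) L) (f s) h ≠ 0 := by
  -- `n = 2` from the doubling datum, so `{n ∕ 2 < re s} = {1 < re s}`
  have hn : n = 2 := by simpa using (Fintype.card_congr e).symm
  have hn1 : (n : ℝ) / 2 = 1 := by rw [hn]; norm_num
  -- `ε_{L∕L⁺}` is unitary (finite order): the hypothesis of ★ p863157's change-of-set letter
  have hε : (quadraticHeckeCharCM L).IsUnitary := (Literature.RepresentationTheory.HarrisKudlaSweet1996.isFiniteOrder_quadraticHeckeCharCM (L := L)).isUnitary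
  intro S hS0 hSd s h hs hX hW0
  rw [hn1] at hs
  have hs' : 1 / 2 < s.re := by linarith
  -- ★ p863404's `hEac` computation: `(s − ½)·((∫β)⁻¹ • W) = X`
  have hsum : ∑ i ∈ I S h, A S i s h * ∏ v ∈ T S h, W S i v s h = ∑ i ∈ I S h, Ac S i s h * ∏ v ∈ T S h, Gn S i v s h :=
    Finset.sum_congr rfl fun i hi => by
      rw [hA S hS0 hSd h i hi s hs]
      exact congrArg _ (Finset.prod_congr rfl fun v hv => hW S hS0 hSd h i hi v hv s hs)
  have hEac : (s - 1 / 2) * (((∫⁻ u, β u ∂νN).toReal⁻¹ : ℝ) • whittakerDelta L e dV hdV dW hdW νN (S : Matrix (Fin n) (Fin n) L) (f s) h) =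
      c S h * (∑ i ∈ I S h, Ac S i s h * ∏ v ∈ T S h, Gn S i v s h) * ((∏ v ∈ Pm S h, ((1 - (v.residueCard : ℂ) ^ (-(2 * s))) / ((1 - (v.residueCard : ℂ) ^ (-(2 * s + 1))) * (1 - (quadraticHeckeCharCM L).valueAtUniformizer v * (v.residueCard : ℂ) ^ (-(2 * s + 2)))))) * G s) * ∏ v ∈ D S h, P S h v s := by
    rw [htail S hS0 hSd s h hs, hsplit S hS0 hSd s hs h, hsum, ← sub_half_mul_scalarK1_union_eq hε T'' (Pm S h) (hPT S h) hsc hs']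
    ring
  -- `W = 0` would make the left-hand side vanish
  rw [hW0, smul_zero, mul_zero] at hEac
  exact hX hEac.symm

end Intrinsic


end Summit.HodgeConjecture.HodgeConjecture.Cruxes.HLiu418.K2LiuKindOneSingularSupportOfLetters

end
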